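import Literature.AnabelianGeometry.SemiGraphs.TemperedAnabelianThm68ivTransport
import Literature.AnabelianGeometry.SemiGraphs.TemperedAnabelianThm68iiiAssembly
import Literature.AnabelianGeometry.SemiGraphs.TemperedAnabelianThm68OriginClosersCor69

/-!
# [SemiAnbd] Thm. 6.8 (iv), first sentence, ASSEMBLED at genus-zero data from the tripod-Belyi leaf (row T68iv-A′), and the origin-level re-knit of F-1682

Mochizuki, *Semi-graphs of anabelioids* [SemiAnbd], §6 Thm. 6.8 (iv), ms. p. 75: «the isomorphism `α`
preserves the decomposition groups of the algebraic closed points»; printed proof = [GalSect] Cor. 2.8 and its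
proof, ms. p. 11. [cite: MochizukiSemiAnbd2006, Thm 6.8(iv) p.75] [cite: MochizukiGalSect2005, Cor 2.8 p.11]

Proof-only companion (abc-iut cell, layer L3, seat abc-iut-L3-t7; row «Q-IV·TRIPOD-DESCENT»; sub-DAG re-cut
of Thm. 6.8 (iv): statements `TemperedAnabelianThm68ivSub.lean`, transport `TemperedAnabelianThm68ivTransport.lean`):
* `Thm68Sub.isTemperedDLocType_of_tripodBelyiWitness` — a tripod-Belyi witness is a witness of tempered
  `DLoc`-type (Def. 6.7); hence at genus-zero data `AlgebraicIffTripodBelyi` yields the content of T68iv-L04;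
* `Thm68Sub.preservesDecompOf_algebraic_of_tripodBelyi` / `isoPreservesAlgebraicDecomp_of_tripodBelyi` —
  **T68iv-A′**: `TemperedCurve.IsoPreservesAlgebraicDecomp X Y aX aY α` at GENUS-ZERO data
  (`CuspidallyGenerated`) from the interface iff `AlgebraicIffTripodBelyi` for both curves, the transport
  (`tripodBelyiWitness_transport`, for `α` and `α⁻¹`) and its named inputs — verbatim the pattern of T68iii-A
  (`isoPreservesTorsionDecomp_of`);
* `TemperedMorphismOrigin.decompositionPreservationHolds_of_parts_of_tripodBelyi` — the F-1682 closer of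
  `TemperedAnabelianThm68OriginClosersCor69.lean` with the verbatim Thm. 6.8 (iv) binder `hIV` REPLACED by:
  T68i-L02 (objects hit on the nose), the leaf `AlgebraicIffTripodBelyi` at certified data, and ONE displayed
  binder `hred` = the printed reduction «one reduces immediately to the case where both `X_K` and `Y_L` are of
  genus zero» (p. 11 l. 1–3; sub-DAG row T68iv-L02, interface level, not typed) — stated as «the genus-zero
  case at all certified data implies the isogenous-to-genus-zero case».
HONEST LABEL: a re-cut/reduction, not a discharge — Thm. 6.8 (iv) stays a FACT-policy node; the leaves are
assumption binders on OUR typed statements; the ⇐ half of `AlgebraicIffTripodBelyi` is the classical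
Belyi-descent (GAP G-L3t7g10-1).  Nothing of [SemiAnbd]/[GalSect]/[Belyi] is asserted; nothing here takes a
side on [IUTchIII] Cor. 3.12.
-/

noncomputable section

namespace Literature.AnabelianGeometry.SemiGraphs

open scoped Pointwise
open CategoryTheory Topology

variable {p : ℕ} [Fact p.Prime]

namespace Thm68Sub

variable {X Y : TemperedCurve p}

/-! ### Bookkeeping: tripod-Belyi witnesses are `DLoc`-type witnesses -/

/-- A tripod-Belyi witness of `x` is in particular a witness that `x` is of tempered `DLoc`-type (Def. 6.7,
`TemperedCurve.IsTemperedDLocType`): clause (7) is Def. 6.7 for the arrow `ψ ≫ π : B → X_K`.  PROVED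
(bookkeeping). [cite: MochizukiSemiAnbd2006, Def 6.7 p.74] -/
theorem isTemperedDLocType_of_tripodBelyiWitness (X : TemperedCurve p) (D : DLocSchemeData X) {x : X.Pt}
    (h : TripodBelyiWitness X D x) : X.IsTemperedDLocType D.toDLocContext x := by
  letI := D.catK; letI := DLocObj.dlocCategory X
  obtain ⟨B, S', T, ψ, π, ι, g, -, -, -, -, -, -, ⟨Dz, γ, hDz, hx⟩, -⟩ := h
  exact ⟨B, ψ ≫ π, Dz, γ, hDz, hx⟩

/-- At genus-zero data, `AlgebraicIffTripodBelyi` gives: every algebraic closed point is of tempered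
`DLoc`-type (the content of T68iv-L04 `AlgebraicIsTemperedDLocType` there, with the genus-zero hypothesis of
print's Belyi step explicit). PROVED (bookkeeping). [cite: MochizukiGalSect2005, Cor 2.8 p.11] -/
theorem isTemperedDLocType_of_algebraic (X : TemperedCurve p) (D : DLocSchemeData X)
    (a : TemperedCurve.CurveArithmeticFlags X) (h0 : CuspidallyGenerated X)
    (hiff : AlgebraicIffTripodBelyi X D a) {x : X.Pt} (hx : a.IsAlgebraicPt x) :
    X.IsTemperedDLocType D.toDLocContext x :=
  isTemperedDLocType_of_tripodBelyiWitness X D ((hiff h0 x).1 hx)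

/-! ### T68iv-A′: assembly of Thm. 6.8 (iv), first sentence, at genus-zero data -/

/-- **One direction of [GalSect] Cor. 2.8 at genus zero, transported** — for `x` algebraic: its tripod-Belyi
witness (`AlgebraicIffTripodBelyi` ⇒) goes along `α` to a tripod-Belyi witness of some `y`
(`tripodBelyiWitness_transport`), which is therefore algebraic (`AlgebraicIffTripodBelyi` ⇐, Belyi-descent),
with `α(D_x)` a conjugate of `D_y`. [cite: MochizukiGalSect2005, Cor 2.8 p.11] -/
theorem exists_algebraic_of_algebraic (DXs : DLocSchemeData X) (DYs : DLocSchemeData Y)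
    (aX : TemperedCurve.CurveArithmeticFlags X) (aY : TemperedCurve.CurveArithmeticFlags Y)
    (α : X.PiTemp ≃ₜ* Y.PiTemp)
    (hΔ : X.DeltaTemp.map α.toMulEquiv.toMonoidHom = Y.DeltaTemp)
    (h65 : X.IsoPreservesCuspidalDecomp Y) (h65' : Y.IsoPreservesCuspidalDecomp X)
    (h65iii : ∀ (Z : DXs.DLocK) (Z' : DYs.DLocK),
      (DXs.curve Z).IsoPreservesCuspidalDecomp (DYs.curve Z'))
    (h65iii' : ∀ (Z' : DYs.DLocK) (Z : DXs.DLocK),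
      (DYs.curve Z').IsoPreservesCuspidalDecomp (DXs.curve Z))
    (hFullY : PiFunctorFull Y DYs) (hCovY : CoveringObjectOfOpenSubgroup Y DYs)
    (hNoseY : ObjectsHitOnTheNose Y DYs) (hB4Y : CuspImageOpenInDecomp Y DYs)
    (hcX : DecompCompact X) (hcY : DecompCompact Y)
    (hctX : X.DecompCommensurablyTerminal) (hctY : Y.DecompCommensurablyTerminal)
    (h0X : CuspidallyGenerated X) (h0Y : CuspidallyGenerated Y)
    (hiffX : AlgebraicIffTripodBelyi X DXs aX) (hiffY : AlgebraicIffTripodBelyi Y DYs aY)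
    {x : X.Pt} (hx : aX.IsAlgebraicPt x) :
    ∃ y : Y.Pt, aY.IsAlgebraicPt y ∧
      ∃ γ' : ConjAct Y.PiTemp, (X.decomp x).map α.toMulEquiv.toMonoidHom = γ' • Y.decomp y := by
  obtain ⟨y, hy, γ', hconj⟩ := tripodBelyiWitness_transport DXs DYs α hΔ h65 h65' h65iii h65iii' hFullY
    hCovY hNoseY hB4Y hcX hcY hctX hctY ((hiffX h0X x).1 hx)
  exact ⟨y, (hiffY h0Y y).2 hy, γ', hconj⟩

/-- **T68iv-A′ core**: at genus-zero data, `α` carries the conjugates of the `D_x`, `x` algebraic, exactly onto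
the conjugates of the `D_y`, `y` algebraic (`PreservesDecompOf`) — from `AlgebraicIffTripodBelyi` for both
curves and the transport for `α` and `α⁻¹`; verbatim the pattern of T68iii-A (`isoPreservesTorsionDecomp_of`).
[cite: MochizukiSemiAnbd2006, Thm 6.8(iv) p.75] [cite: MochizukiGalSect2005, Cor 2.8 p.11] -/
theorem preservesDecompOf_algebraic_of_tripodBelyi (DXs : DLocSchemeData X) (DYs : DLocSchemeData Y)
    (aX : TemperedCurve.CurveArithmeticFlags X) (aY : TemperedCurve.CurveArithmeticFlags Y)
    (α : X.PiTemp ≃ₜ* Y.PiTemp)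
    (hΔ : X.DeltaTemp.map α.toMulEquiv.toMonoidHom = Y.DeltaTemp)
    (h65 : X.IsoPreservesCuspidalDecomp Y) (h65' : Y.IsoPreservesCuspidalDecomp X)
    (h65iii : ∀ (Z : DXs.DLocK) (Z' : DYs.DLocK),
      (DXs.curve Z).IsoPreservesCuspidalDecomp (DYs.curve Z'))
    (h65iii' : ∀ (Z' : DYs.DLocK) (Z : DXs.DLocK),
      (DYs.curve Z').IsoPreservesCuspidalDecomp (DXs.curve Z))
    (hFullX : PiFunctorFull X DXs) (hFullY : PiFunctorFull Y DYs)
    (hCovX : CoveringObjectOfOpenSubgroup X DXs) (hCovY : CoveringObjectOfOpenSubgroup Y DYs)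
    (hNoseX : ObjectsHitOnTheNose X DXs) (hNoseY : ObjectsHitOnTheNose Y DYs)
    (hB4X : CuspImageOpenInDecomp X DXs) (hB4Y : CuspImageOpenInDecomp Y DYs)
    (hcX : DecompCompact X) (hcY : DecompCompact Y)
    (hctX : X.DecompCommensurablyTerminal) (hctY : Y.DecompCommensurablyTerminal)
    (h0X : CuspidallyGenerated X) (h0Y : CuspidallyGenerated Y)
    (hiffX : AlgebraicIffTripodBelyi X DXs aX) (hiffY : AlgebraicIffTripodBelyi Y DYs aY) :
    TemperedCurve.PreservesDecompOf X Y α {x | aX.IsAlgebraicPt x} {y | aY.IsAlgebraicPt y} := by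
  intro D
  constructor
  · rintro ⟨x, hx, γ, rfl⟩
    obtain ⟨y, hy, γ', hconj⟩ := exists_algebraic_of_algebraic DXs DYs aX aY α hΔ h65 h65' h65iii h65iii'
      hFullY hCovY hNoseY hB4Y hcX hcY hctX hctY h0X h0Y hiffX hiffY hx
    refine ⟨y, hy, ConjAct.toConjAct (α (ConjAct.ofConjAct γ)) * γ', ?_⟩
    have h1 : (γ • X.decomp x).map α.toMulEquiv.toMonoidHom =
        ConjAct.toConjAct (α (ConjAct.ofConjAct γ)) • (X.decomp x).map α.toMulEquiv.toMonoidHom := by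
      have := map_smul_eq α.toMulEquiv.toMonoidHom (ConjAct.ofConjAct γ) (X.decomp x)
      rw [ConjAct.toConjAct_ofConjAct] at this
      exact this
    rw [h1, hconj, mul_smul]
  · rintro ⟨y, hy, γ, hD⟩
    obtain ⟨x, hx, γ'', hconj⟩ := exists_algebraic_of_algebraic DYs DXs aY aX α.symm
      (deltaTemp_map_symm α hΔ) h65' h65 h65iii' h65iii hFullX hCovX hNoseX hB4X hcY hcX hctY hctX h0Y h0X
      hiffY hiffX hy
    refine ⟨x, hx, ConjAct.toConjAct (α.symm (ConjAct.ofConjAct γ)) * γ'', ?_⟩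
    have h1 : (γ • Y.decomp y).map α.symm.toMulEquiv.toMonoidHom =
        ConjAct.toConjAct (α.symm (ConjAct.ofConjAct γ)) •
          (Y.decomp y).map α.symm.toMulEquiv.toMonoidHom := by
      have := map_smul_eq α.symm.toMulEquiv.toMonoidHom (ConjAct.ofConjAct γ) (Y.decomp y)
      rw [ConjAct.toConjAct_ofConjAct] at this
      exact this
    rw [← map_map_symm α D, hD, h1, hconj, mul_smul]

/-- **T68iv-A′ ASSEMBLED modulo named inputs, at genus-zero data** — [SemiAnbd] Thm. 6.8 (iv), first sentence,
`TemperedCurve.IsoPreservesAlgebraicDecomp X Y aX aY α`, for curves of genus zero (`CuspidallyGenerated`;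
the isogeny flags in the typed statement are then vacuous antecedents — the reduction «isogenous to genus
zero ⇒ genus zero» is the separate row T68iv-L02). [cite: MochizukiSemiAnbd2006, Thm 6.8(iv) p.75] -/
theorem isoPreservesAlgebraicDecomp_of_tripodBelyi (DXs : DLocSchemeData X) (DYs : DLocSchemeData Y)
    (aX : TemperedCurve.CurveArithmeticFlags X) (aY : TemperedCurve.CurveArithmeticFlags Y)
    (α : X.PiTemp ≃ₜ* Y.PiTemp)
    (hΔ : X.DeltaTemp.map α.toMulEquiv.toMonoidHom = Y.DeltaTemp)
    (h65 : X.IsoPreservesCuspidalDecomp Y) (h65' : Y.IsoPreservesCuspidalDecomp X)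
    (h65iii : ∀ (Z : DXs.DLocK) (Z' : DYs.DLocK),
      (DXs.curve Z).IsoPreservesCuspidalDecomp (DYs.curve Z'))
    (h65iii' : ∀ (Z' : DYs.DLocK) (Z : DXs.DLocK),
      (DYs.curve Z').IsoPreservesCuspidalDecomp (DXs.curve Z))
    (hFullX : PiFunctorFull X DXs) (hFullY : PiFunctorFull Y DYs)
    (hCovX : CoveringObjectOfOpenSubgroup X DXs) (hCovY : CoveringObjectOfOpenSubgroup Y DYs)
    (hNoseX : ObjectsHitOnTheNose X DXs) (hNoseY : ObjectsHitOnTheNose Y DYs)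
    (hB4X : CuspImageOpenInDecomp X DXs) (hB4Y : CuspImageOpenInDecomp Y DYs)
    (hcX : DecompCompact X) (hcY : DecompCompact Y)
    (hctX : X.DecompCommensurablyTerminal) (hctY : Y.DecompCommensurablyTerminal)
    (h0X : CuspidallyGenerated X) (h0Y : CuspidallyGenerated Y)
    (hiffX : AlgebraicIffTripodBelyi X DXs aX) (hiffY : AlgebraicIffTripodBelyi Y DYs aY) :
    TemperedCurve.IsoPreservesAlgebraicDecomp X Y aX aY α :=
  fun _ _ => preservesDecompOf_algebraic_of_tripodBelyi DXs DYs aX aY α hΔ h65 h65' h65iii h65iii' hFullX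
    hFullY hCovX hCovY hNoseX hNoseY hB4X hB4Y hcX hcY hctX hctY h0X h0Y hiffX hiffY

end Thm68Sub

/-! ### The origin-level re-knit of the F-1682 closer -/

namespace TemperedMorphismOrigin

open Thm68Sub

/-- **[SemiAnbd] Thm. 6.8 (iii)(iv) and Cor. 6.9 as printed (`DecompositionPreservationHolds`, FACT-LIST
F-1682), REDUCED to named leaves — Thm. 6.8 (iv), first sentence, no longer a verbatim binder.**  As
`decompositionPreservationHolds_of_parts_of_sectionCriterion` (p491272: torsion clause (iii) ⟸ its leaves;
"in particular" of (iv) ⟸ first sentence + T68iv-L05; Cor. 6.9 ⟸ the tempered Lemma 3.1 criterion `hcrit`),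
with the binder `hIV` (Thm. 6.8 (iv) first sentence at all certified data) now DERIVED from: T68i-L02
`ObjectsHitOnTheNose` at certified `DLoc` data (`hL02`); the interface iff `AlgebraicIffTripodBelyi` at
certified data (`hiff`; ⇒ = [Belyi] + [GalSect] p. 11, ⇐ = Belyi-descent, GAP G-L3t7g10-1); the genus-zero
assembly `preservesDecompOf_algebraic_of_tripodBelyi`; and ONE displayed binder `hred` = the printed reduction
«By Theorem 1.3, (ii), and [the "Loc_K(−) portion" … of] Theorem 2.3, (ii), one reduces immediately to the case
where both `X_K` and `Y_L` are of genus zero» ([GalSect] p. 11 l. 1–3; sub-DAG row T68iv-L02, interface level,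
NOT typed: finite-étale-localization datum) — «the statement at all certified GENUS-ZERO data implies it at all
certified data».  Nothing of [SemiAnbd]/[GalSect]/[Belyi] is asserted; FACT-policy respected (a reduction, not
a discharge). [cite: MochizukiSemiAnbd2006, Thm 6.8(iii)-(iv), Cor 6.9 pp.75-77]
[cite: MochizukiGalSect2005, Cor 2.8 p.11] -/
theorem decompositionPreservationHolds_of_parts_of_tripodBelyi (Ω : TemperedMorphismOrigin p)
    (hD : ∀ X : TemperedCurve p, Ω.IsHyperbolicCurveOrigin X →
      ∃ D : DLocSchemeData X, Ω.IsDLocOrigin D.toDLocContext)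
    (hcurve : ∀ (X : TemperedCurve p) (D : DLocSchemeData X) (Z : D.DLocK),
      Ω.IsHyperbolicCurveOrigin X → Ω.IsDLocOrigin D.toDLocContext →
        Ω.IsHyperbolicCurveOrigin (D.curve Z))
    (hL01 : ∀ (X : TemperedCurve p) (D : DLocSchemeData X), Ω.IsHyperbolicCurveOrigin X →
      Ω.IsDLocOrigin D.toDLocContext → CoveringObjectOfOpenSubgroup X D)
    (hL02 : ∀ (X : TemperedCurve p) (D : DLocSchemeData X), Ω.IsHyperbolicCurveOrigin X →
      Ω.IsDLocOrigin D.toDLocContext → ObjectsHitOnTheNose X D)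
    (hL04 : ∀ (X : TemperedCurve p) (D : DLocSchemeData X), Ω.IsHyperbolicCurveOrigin X →
      Ω.IsDLocOrigin D.toDLocContext → PiFunctorBijectiveOnHom X D)
    (hB4 : ∀ (X : TemperedCurve p) (D : DLocSchemeData X), Ω.IsHyperbolicCurveOrigin X →
      Ω.IsDLocOrigin D.toDLocContext → CuspImageOpenInDecomp X D)
    (hB1 : ∀ X : TemperedCurve p, Ω.IsHyperbolicCurveOrigin X → DecompCompact X)
    (h65 : Ω.CuspidalAbsolutenessHolds) (h65i : Ω.TemperedDecompositionGroupsHolds)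
    (hΔ : ∀ X Y : TemperedCurve p, Ω.IsHyperbolicCurveOrigin X → Ω.IsHyperbolicCurveOrigin Y →
      ∀ α : X.PiTemp ≃ₜ* Y.PiTemp, X.DeltaTemp.map α.toMulEquiv.toMonoidHom = Y.DeltaTemp)
    (hT04 : ∀ (X : TemperedCurve p) (D : DLocSchemeData X) (a : TemperedCurve.CurveArithmeticFlags X),
      Ω.IsHyperbolicCurveOrigin X → Ω.IsDLocOrigin D.toDLocContext → Ω.IsFlagsOrigin a →
        TorsionIffMulNCuspImage X D a)
    (hcusp : ∀ (X : TemperedCurve p) (a : TemperedCurve.CurveArithmeticFlags X),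
      Ω.IsHyperbolicCurveOrigin X → Ω.IsFlagsOrigin a → a.IsOncePuncturedElliptic →
        ∀ x : X.Pt, X.IsCusp x → a.IsTorsionPt x)
    (hL05 : ∀ (X : TemperedCurve p) (a : TemperedCurve.CurveArithmeticFlags X),
      Ω.IsHyperbolicCurveOrigin X → Ω.IsFlagsOrigin a → DefinedOverNFIffExistsAlgebraic X a)
    (hiff : ∀ (X : TemperedCurve p) (D : DLocSchemeData X) (a : TemperedCurve.CurveArithmeticFlags X),
      Ω.IsHyperbolicCurveOrigin X → Ω.IsDLocOrigin D.toDLocContext → Ω.IsFlagsOrigin a →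
        AlgebraicIffTripodBelyi X D a)
    (hred : (∀ (X₀ Y₀ : TemperedCurve p) (aX₀ : TemperedCurve.CurveArithmeticFlags X₀)
        (aY₀ : TemperedCurve.CurveArithmeticFlags Y₀), Ω.IsHyperbolicCurveOrigin X₀ →
        Ω.IsHyperbolicCurveOrigin Y₀ → Ω.IsFlagsOrigin aX₀ → Ω.IsFlagsOrigin aY₀ →
        CuspidallyGenerated X₀ → CuspidallyGenerated Y₀ → ∀ α₀ : X₀.PiTemp ≃ₜ* Y₀.PiTemp,
          TemperedCurve.PreservesDecompOf X₀ Y₀ α₀ {x | aX₀.IsAlgebraicPt x} {y | aY₀.IsAlgebraicPt y}) →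
      ∀ (X Y : TemperedCurve p) (aX : TemperedCurve.CurveArithmeticFlags X)
        (aY : TemperedCurve.CurveArithmeticFlags Y), Ω.IsHyperbolicCurveOrigin X →
        Ω.IsHyperbolicCurveOrigin Y → Ω.IsFlagsOrigin aX → Ω.IsFlagsOrigin aY →
          ∀ α : X.PiTemp ≃ₜ* Y.PiTemp, X.IsoPreservesAlgebraicDecomp Y aX aY α)
    (hcrit : ∀ (X : TemperedCurve p) (a : TemperedCurve.CurveArithmeticFlags X),
      Ω.IsHyperbolicCurveOrigin X → Ω.IsFlagsOrigin a → a.IsDefinedOverNumberField →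
        ∀ D : Subgroup X.PiTemp, IsCompact (D : Set X.PiTemp) → D ⊓ X.DeltaTemp = ⊥ →
          IsOpen ((D ⊔ X.DeltaTemp : Subgroup X.PiTemp) : Set X.PiTemp) →
          (∀ c : X.Pt, X.IsCusp c → ∀ γ : ConjAct X.PiTemp, ¬ D ≤ γ • X.decomp c) →
          ((∃ x : X.Pt, ∃ γ : ConjAct X.PiTemp, D = γ • X.decomp x ⊓ (D ⊔ X.DeltaTemp)) ↔
            ∀ H : Subgroup X.PiTemp, IsOpen (H : Set X.PiTemp) → D ≤ H →
              ∃ x' : X.Pt, a.IsAlgebraicPt x' ∧ ∃ γ : ConjAct X.PiTemp,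
                γ • X.decomp x' ⊓ (D ⊔ X.DeltaTemp) ≤ H ∧
                  D ⊔ X.DeltaTemp ≤ γ • X.decomp x' ⊔ X.DeltaTemp)) :
    Ω.DecompositionPreservationHolds := by
  refine Ω.decompositionPreservationHolds_of_parts_of_sectionCriterion hD hcurve hL01 hL04 hB4 hB1 h65 h65i
    hΔ hT04 hcusp hL05 ?_ hcrit
  refine hred ?_
  intro X₀ Y₀ aX₀ aY₀ hX hY haX haY h0X h0Y α₀
  obtain ⟨DX, hDX⟩ := hD X₀ hX
  obtain ⟨DY, hDY⟩ := hD Y₀ hY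
  exact preservesDecompOf_algebraic_of_tripodBelyi DX DY aX₀ aY₀ α₀ (hΔ X₀ Y₀ hX hY α₀) (h65 X₀ Y₀ hX hY)
    (h65 Y₀ X₀ hY hX)
    (fun Z Z' => h65 _ _ (hcurve X₀ DX Z hX hDX) (hcurve Y₀ DY Z' hY hDY))
    (fun Z' Z => h65 _ _ (hcurve Y₀ DY Z' hY hDY) (hcurve X₀ DX Z hX hDX))
    (full_and_faithful_of_bijectiveOnHom X₀ DX (hL04 X₀ DX hX hDX)).1
    (full_and_faithful_of_bijectiveOnHom Y₀ DY (hL04 Y₀ DY hY hDY)).1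
    (hL01 X₀ DX hX hDX) (hL01 Y₀ DY hY hDY) (hL02 X₀ DX hX hDX) (hL02 Y₀ DY hY hDY)
    (hB4 X₀ DX hX hDX) (hB4 Y₀ DY hY hDY) (hB1 X₀ hX) (hB1 Y₀ hY)
    (h65i X₀ hX).2.2.1 (h65i Y₀ hY).2.2.1 h0X h0Y (hiff X₀ DX aX₀ hX hDX haX) (hiff Y₀ DY aY₀ hY hDY haY)

end TemperedMorphismOrigin

end Literature.AnabelianGeometry.SemiGraphs

end
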